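import Summits.QuantumFields.YangMills.Theorems.SwapVirialDeficitBlowUpPeriodicDominator
import Summits.QuantumFields.YangMills.Theorems.SwapVirialDeficitBlowUpLogSqueeze
import Summits.QuantumFields.YangMills.Theorems.SwapVirialDeficitFixedLRelativeGapOfLimits
import Summits.QuantumFields.YangMills.Theorems.SwapVirialDeficitBlowUpRingPointwise
import HarnessLib

/-!
# The PERIODIC massive-mode rung, brick PJ6: ASSEMBLY — the principal zero-flux log-limit and the fixed-`L` periodic mean action MODULO THE TWO-SCALE
# FIBRE LIMIT (PM), everything else discharged
# (free-hands support of ⟨stmt-QuantumFields-24196⟩ `SwapVirialDeficit.ToronSoftnessSharp`; memo `w3-g64-memo-24196-periodic-massive-mode-rung.md` §2 PJ6)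

The periodic rung in one theorem.  Of the four hypotheses of the log-squeeze lemma ✓`BlowUp.tendsto_div_log_of_twoScale` for the periodic kernel
`K_t = periodicKernel 0 1 t t²` (✓PH), (deep) and (outer) are ✓`periodicKernel_deep` ∕ ✓`periodicKernel_outer` (PD-II); the remaining two — the MIDDLE-REGION
two-scale bounds (upper)/(lower), i.e. brick PM — are taken here as explicit hypotheses, stated exactly as PM must deliver them:
* ★★★ `periodicPrincipalLogLimit_of_twoScale` — (upper) + (lower) with a middle mass `gI > 0` ⟹
  `Tendsto (fun s => μ_L.real{F₀ ≤ s} / (s^{9L⁴−3/2}·log s⁻¹)) (𝓝[>] 0) (𝓝 (coneConst^{6L⁴+1}·gI/4))` — the hypothesis `hlim` of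
  ✓`PeriodicRing.tendsto_periodicMeanAction_of_principalLogLimit` (✓`ringMeasure_ringDeficit_le_eq_kernel_sqrt`, `log(1/u) = 2·log(1/√u)`);
* ★★★ `periodicMeanAction_fixedL_of_twoScale` — hence `b·(log W₀)′(b) − 12bL⁴ → −(9L⁴ − 3/2)` and the fixed-`L` ∀ε periodic softness, and with the σ-glued
  principal limit ★★ `relativeGap_fixedL_of_twoScale` (`L ≥ L₀(ε)`): `β(log Z^S)′ − β(log Z_phys)′ ≤ −(1/2 − 2ε)` eventually — all BY NAME.
So the periodic side of LINE g14-B's fixed-`L` relative gap now rests on ONE analytic statement, PM: on the middle region `A√t < ρ ≤ δ` the hub-radial kernel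
is `G(a₀)/ρ` up to `ε` in integrated form (the two-scale fibre limit with followers; K4 twins ✓`tendsto_volume_twoScale`, ✓`tendsto_volume_twoScale_origin`).
HONEST LABEL: conditional assembly (an implication, sorry-free); PM is NOT proved; ⟨24196⟩ ∕ ⟨24194⟩ ∕ ⟨24197⟩ ∕ ⟨24497⟩ (window-uniform) stay OPEN; own crux ⟨22884⟩
OPEN (blocked-on ⟨19935⟩); the Yang–Mills mass gap is NOT proved; no summit is proved by a line.
Width seat ym-line-sfw-p2-w3 g64 (cell ym-idea-1, free hands), `--supports stmt-QuantumFields-24196`.  THEOREMS ONLY (0 `def`, 0 `sorry`), standard axioms.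
References: [cite: Luscher1983, §2]; [cite: GonzalezarroyoAltes1988]; [cite: Griffiths1964]; [folklore].
-/

set_option autoImplicit false

noncomputable section

open MeasureTheory Quaternion Set Filter Topology
open scoped Quaternion ENNReal BigOperators
open Literature.MathematicalPhysics.QuantumLattice
open Literature.MathematicalPhysics.QuantumFieldTheory hiding SU2
open Summit.QuantumFields.YangMills.Theorems.SwapTwistDeficit.ToronLog

attribute [local instance] Literature.Analysis.FluidPDE.Tao2016.quatMeasurableSpace
  Literature.Analysis.FluidPDE.Tao2016.quatBorelSpace
  Literature.MathematicalPhysics.QuantumLattice.secondCountableTopology_su2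

namespace Summit.QuantumFields.YangMills.Theorems.SwapVirialDeficit.BlowUpRing

open Summit.QuantumFields.YangMills.Theorems.FemtoTransferGap
open Summit.QuantumFields.YangMills.Theorems.FemtoTransferGap.TT
open Summit.QuantumFields.YangMills.Theorems.VirialFluxGap.RingDeficit
open Summit.QuantumFields.YangMills.Theorems.SwapVirialDeficit.BlowUp (tendsto_div_log_of_twoScale)
open Summit.QuantumFields.YangMills.Theorems.SwapVirialDeficit.PeriodicRing (tendsto_periodicMeanAction_of_principalLogLimit
  periodicSoftness_fixedL_of_principalLogLimit relativeGap_fixedL_of_limits)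
open Summit.QuantumFields.YangMills.Theorems.SwapVirialDeficit.SwapRing (swapRingDeficit)

variable {L : ℕ} [NeZero L]

/-! ## §1 The principal zero-flux log-limit modulo the two-scale fibre limit -/

/-- `√` maps `𝓝[>] 0` into `𝓝[>] 0`. [folklore] -/
theorem tendsto_sqrt_nhdsGT_zero : Tendsto Real.sqrt (𝓝[>] (0 : ℝ)) (𝓝[>] (0 : ℝ)) := by
  refine tendsto_nhdsWithin_iff.2 ⟨?_, ?_⟩
  · have h := Real.continuous_sqrt.tendsto (0 : ℝ)
    rw [Real.sqrt_zero] at h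
    exact tendsto_nhdsWithin_of_tendsto_nhds h
  · filter_upwards [self_mem_nhdsWithin] with u hu using Real.sqrt_pos.2 hu

/-- ★★★ **THE PERIODIC PRINCIPAL LOG-LIMIT, MODULO PM.**  If on the middle region the periodic kernel `K_t = periodicKernel 0 1 t t²` has a two-scale majorant and
minorant `G(a₀)/ρ` with total mass within `ε` of `gI > 0` (hypotheses (upper)/(lower) of ✓`BlowUp.tendsto_div_log_of_twoScale`, = brick PM), then
`μ_L.real{F₀ ≤ s}/(s^{9L⁴−3/2}·log s⁻¹) → coneConst^{6L⁴+1}·gI/4` as `s → 0⁺` — the hypothesis `hlim` of ✓`tendsto_periodicMeanAction_of_principalLogLimit`.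
((deep)/(outer): ✓`periodicKernel_deep`/✓`periodicKernel_outer`; scaling: ✓`ringMeasure_ringDeficit_le_eq_kernel_sqrt`.) [cite: Luscher1983, §2] [cite: GonzalezarroyoAltes1988] -/
theorem periodicPrincipalLogLimit_of_twoScale (L : ℕ) [NeZero L] {gI : ℝ} (hgI : 0 ≤ gI)
    (hupper : ∀ ε : ℝ, 0 < ε → ∃ A δ : ℝ, 0 < A ∧ 0 < δ ∧ ∃ G : ℝ → ℝ≥0∞, ∫⁻ x, G x ∂(volume : Measure ℝ) ≤ ENNReal.ofReal (gI + ε) ∧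
      ∀ᶠ t in 𝓝[>] (0 : ℝ), ∀ a₀ : ℝ, ∀ ρ ∈ Ioc (A * Real.sqrt t) δ,
        periodicKernel L (fun _ => false) (fun _ => 1) t (t ^ 2) (a₀, ρ) ≤ G a₀ * ENNReal.ofReal ρ⁻¹)
    (hlower : ∀ ε : ℝ, 0 < ε → ∃ A δ : ℝ, 0 < A ∧ 0 < δ ∧ ∃ G : ℝ → ℝ≥0∞, ENNReal.ofReal (gI - ε) ≤ ∫⁻ x, G x ∂(volume : Measure ℝ) ∧
      ∀ᶠ t in 𝓝[>] (0 : ℝ), ∀ a₀ : ℝ, ∀ ρ ∈ Ioc (A * Real.sqrt t) δ,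
        G a₀ * ENNReal.ofReal ρ⁻¹ ≤ periodicKernel L (fun _ => false) (fun _ => 1) t (t ^ 2) (a₀, ρ)) :
    Tendsto (fun s : ℝ => (ringMeasure L).real {P | ringDeficit L (fun _ => false) P ≤ s} / (s ^ (9 * (L : ℝ) ^ 4 - 3 / 2) * Real.log s⁻¹))
      (𝓝[>] 0) (𝓝 (coneConst ^ (6 * L ^ 4 + 1) * gI / 4)) := by
  -- the log-squeeze lemma for `K t := periodicKernel 0 1 t (t²)`
  set K : ℝ → ℝ × ℝ → ℝ≥0∞ := fun t => periodicKernel L (fun _ => false) (fun _ => 1) t (t ^ 2) with hK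
  have hKm : ∀ t, Measurable (K t) := fun t => measurable_periodicKernel _ _ t _
  have hdeep : ∀ A : ℝ, 0 < A → ∃ C : ℝ≥0∞, C ≠ ∞ ∧ ∀ᶠ t in 𝓝[>] (0 : ℝ),
      ∫⁻ x, (∫⁻ ρ in Ioc 0 (A * Real.sqrt t), K t (x, ρ)) ∂(volume : Measure ℝ) ≤ C := by
    intro A hA
    obtain ⟨C, hC, h⟩ := periodicKernel_deep (L := L) (r := 1) zero_le_one A hA
    refine ⟨C, hC, ?_⟩
    filter_upwards [h] with t ht
    simpa only [hK, one_mul] using ht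
  have houter : ∀ δ : ℝ, 0 < δ → ∃ C : ℝ≥0∞, C ≠ ∞ ∧ ∀ᶠ t in 𝓝[>] (0 : ℝ),
      ∫⁻ x, (∫⁻ ρ in Ioi δ, K t (x, ρ)) ∂(volume : Measure ℝ) ≤ C := by
    intro δ hδ
    obtain ⟨C, hC, h⟩ := periodicKernel_outer (L := L) (r := 1) zero_le_one δ hδ
    refine ⟨C, hC, ?_⟩
    filter_upwards [h] with t ht
    simpa only [hK, one_mul] using ht
  have hT := tendsto_div_log_of_twoScale (volume : Measure ℝ) hKm hgI hdeep houter hupper hlower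
  -- compose with `u ↦ √u` and rescale: `μ.real{F ≤ u}/(u^α·log u⁻¹) = c · (∫∫K_{√u}).toReal/(2·log(1/√u))`
  have hT2 := hT.comp tendsto_sqrt_nhdsGT_zero
  have hc0 : 0 ≤ coneConst := by rw [coneConst]; exact ENNReal.toReal_nonneg
  have hlim2 : Tendsto (fun u : ℝ => coneConst ^ (6 * L ^ 4 + 1) / 2 *
      ((∫⁻ x, (∫⁻ ρ in Ioi 0, K (Real.sqrt u) (x, ρ)) ∂(volume : Measure ℝ)).toReal / Real.log (1 / Real.sqrt u))) (𝓝[>] (0 : ℝ))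
      (𝓝 (coneConst ^ (6 * L ^ 4 + 1) / 2 * (gI / 2))) := hT2.const_mul _
  rw [show coneConst ^ (6 * L ^ 4 + 1) * gI / 4 = coneConst ^ (6 * L ^ 4 + 1) / 2 * (gI / 2) by ring]
  refine hlim2.congr' ?_
  filter_upwards [self_mem_nhdsWithin, Ioo_mem_nhdsGT (show (0 : ℝ) < 1 by norm_num)] with u hu hu1
  have hu0 : 0 < u := hu
  have hsq : 0 < Real.sqrt u := Real.sqrt_pos.2 hu0
  -- the sublevel volume through the kernel at `t = √u`, level `1·u = (√u)²`
  have hvol := ringMeasure_ringDeficit_le_eq_kernel_sqrt (L := L) (fun _ => false) (χ := fun _ => 1) (fun _ k => by rw [one_mul, mul_one]) 1 hu0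
  simp only [one_mul] at hvol
  have hlog : Real.log (1 / Real.sqrt u) = Real.log u⁻¹ / 2 := by
    rw [one_div, Real.log_inv, Real.log_inv, Real.log_sqrt hu0.le]; ring
  have hlogpos : 0 < Real.log u⁻¹ := Real.log_pos (one_lt_inv₀ hu0 |>.2 hu1.2)
  have hα : 0 < u ^ (9 * (L : ℝ) ^ 4 - 3 / 2) := Real.rpow_pos_of_pos hu0 _
  rw [measureReal_def, hvol, ENNReal.toReal_mul, ENNReal.toReal_ofReal (by positivity), hlog]
  simp only [hK, Real.sq_sqrt hu0.le]
  field_simp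

/-! ## §2 The fixed-`L` periodic mean action and the relative gap, modulo PM -/

/-- ★★★ **THE FIXED-`L` PERIODIC MEAN ACTION MODULO PM**: under (upper)/(lower) with `gI > 0`, `b·(log W₀)′(b) − 12bL⁴ → −(9L⁴ − 3/2)`
(✓`tendsto_periodicMeanAction_of_principalLogLimit` ∘ §1). [cite: Griffiths1964] [cite: Luscher1983, §2] -/
theorem periodicMeanAction_fixedL_of_twoScale (L : ℕ) [NeZero L] {gI : ℝ} (hgI : 0 < gI)
    (hupper : ∀ ε : ℝ, 0 < ε → ∃ A δ : ℝ, 0 < A ∧ 0 < δ ∧ ∃ G : ℝ → ℝ≥0∞, ∫⁻ x, G x ∂(volume : Measure ℝ) ≤ ENNReal.ofReal (gI + ε) ∧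
      ∀ᶠ t in 𝓝[>] (0 : ℝ), ∀ a₀ : ℝ, ∀ ρ ∈ Ioc (A * Real.sqrt t) δ,
        periodicKernel L (fun _ => false) (fun _ => 1) t (t ^ 2) (a₀, ρ) ≤ G a₀ * ENNReal.ofReal ρ⁻¹)
    (hlower : ∀ ε : ℝ, 0 < ε → ∃ A δ : ℝ, 0 < A ∧ 0 < δ ∧ ∃ G : ℝ → ℝ≥0∞, ENNReal.ofReal (gI - ε) ≤ ∫⁻ x, G x ∂(volume : Measure ℝ) ∧
      ∀ᶠ t in 𝓝[>] (0 : ℝ), ∀ a₀ : ℝ, ∀ ρ ∈ Ioc (A * Real.sqrt t) δ,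
        G a₀ * ENNReal.ofReal ρ⁻¹ ≤ periodicKernel L (fun _ => false) (fun _ => 1) t (t ^ 2) (a₀, ρ)) :
    Tendsto (fun b : ℝ => b * deriv (fun x : ℝ => Real.log (TT.sectorWeight (L := L) x (2 * L - 1) (fun _ => false) (fun _ _ => (1 : ℝ)))) b -
        12 * b * (L : ℝ) ^ 4) atTop (𝓝 (-(9 * (L : ℝ) ^ 4 - 3 / 2))) := by
  have hc : 0 < coneConst := coneConst_pos
  have hv : 0 < coneConst ^ (6 * L ^ 4 + 1) * gI / 4 := by positivity
  exact tendsto_periodicMeanAction_of_principalLogLimit L hv (periodicPrincipalLogLimit_of_twoScale L hgI.le hupper hlower)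

/-- ★★ **THE FIXED-`L` RELATIVE GAP MODULO THE TWO PRINCIPAL INPUTS, periodic side reduced to PM**: for every `ε > 0` there is `L₀` such that at every fixed
`L ≥ L₀`, the σ-glued principal LIMIT (`v_S > 0`) together with the periodic two-scale middle bounds (upper)/(lower) (`gI > 0`) give, eventually in `β`,
`β·(log Z^S)′(β) − β·(log Z_phys)′(β) ≤ −(1/2 − 2ε)` (✓`relativeGap_fixedL_of_limits` ∘ §1). [cite: Griffiths1964] [cite: tHooft1979] [cite: Luscher1983, §2] -/
theorem relativeGap_fixedL_of_twoScale {ε : ℝ} (hε : 0 < ε) :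
    ∃ L₀ : ℕ, ∀ (L : ℕ) [NeZero L], L₀ ≤ L → ∀ {vS gI : ℝ}, 0 < vS → 0 < gI →
      Tendsto (fun s : ℝ => (ringMeasure L).real {P | swapRingDeficit L (fun _ => false) P ≤ s} / s ^ (9 * L ^ 4 - 1)) (𝓝[>] 0) (𝓝 vS) →
      (∀ ε' : ℝ, 0 < ε' → ∃ A δ : ℝ, 0 < A ∧ 0 < δ ∧ ∃ G : ℝ → ℝ≥0∞, ∫⁻ x, G x ∂(volume : Measure ℝ) ≤ ENNReal.ofReal (gI + ε') ∧
        ∀ᶠ t in 𝓝[>] (0 : ℝ), ∀ a₀ : ℝ, ∀ ρ ∈ Ioc (A * Real.sqrt t) δ,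
          periodicKernel L (fun _ => false) (fun _ => 1) t (t ^ 2) (a₀, ρ) ≤ G a₀ * ENNReal.ofReal ρ⁻¹) →
      (∀ ε' : ℝ, 0 < ε' → ∃ A δ : ℝ, 0 < A ∧ 0 < δ ∧ ∃ G : ℝ → ℝ≥0∞, ENNReal.ofReal (gI - ε') ≤ ∫⁻ x, G x ∂(volume : Measure ℝ) ∧
        ∀ᶠ t in 𝓝[>] (0 : ℝ), ∀ a₀ : ℝ, ∀ ρ ∈ Ioc (A * Real.sqrt t) δ,
          G a₀ * ENNReal.ofReal ρ⁻¹ ≤ periodicKernel L (fun _ => false) (fun _ => 1) t (t ^ 2) (a₀, ρ)) →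
      ∃ β₀ : ℝ, ∀ β : ℝ, β₀ ≤ β →
        β * deriv (fun b : ℝ => Real.log (TT.twistTrace L b (2 * L))) β -
            β * deriv (fun b : ℝ => Real.log (TT.physTrace L b (2 * L))) β ≤ -(1 / 2 - 2 * ε) := by
  obtain ⟨L₀, h⟩ := relativeGap_fixedL_of_limits hε
  refine ⟨L₀, fun L _ hL vS gI hvS hgI hS hup hlo => ?_⟩
  have hc : 0 < coneConst := coneConst_pos
  have hv : 0 < coneConst ^ (6 * L ^ 4 + 1) * gI / 4 := by positivity
  exact h L hL hvS hv hS (periodicPrincipalLogLimit_of_twoScale L hgI.le hup hlo)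

/-- ★★★ **THE FIXED-`L` RELATIVE GAP MODULO THE PERIODIC LOG-LIMIT ONLY**: the σ-glued side is DISCHARGED by the massive-mode rung
✓`BlowUpRing.principal_smallBall_limit` (fcl-p3 g45 ∕ w2 g57, 13:07Z); so for every `ε > 0` there is `L₀` such that at every fixed `L ≥ L₀` the periodic
principal LOG-LIMIT (`v_P > 0`) ALONE gives, eventually in `β`, `β·(log Z^S)′(β) − β·(log Z_phys)′(β) ≤ −(1/2 − 2ε)`. [cite: Griffiths1964] [cite: tHooft1979] -/
theorem relativeGap_fixedL_of_periodicLogLimit {ε : ℝ} (hε : 0 < ε) :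
    ∃ L₀ : ℕ, ∀ (L : ℕ) [NeZero L], L₀ ≤ L → ∀ {vP : ℝ}, 0 < vP →
      Tendsto (fun s : ℝ => (ringMeasure L).real {P | ringDeficit L (fun _ => false) P ≤ s} / (s ^ (9 * (L : ℝ) ^ 4 - 3 / 2) * Real.log s⁻¹))
        (𝓝[>] 0) (𝓝 vP) →
      ∃ β₀ : ℝ, ∀ β : ℝ, β₀ ≤ β →
        β * deriv (fun b : ℝ => Real.log (TT.twistTrace L b (2 * L))) β -
            β * deriv (fun b : ℝ => Real.log (TT.physTrace L b (2 * L))) β ≤ -(1 / 2 - 2 * ε) := by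
  obtain ⟨L₀, h⟩ := relativeGap_fixedL_of_limits hε
  refine ⟨L₀, fun L _ hL vP hvP hP => ?_⟩
  obtain ⟨vS, hvS, hS⟩ := principal_smallBall_limit L
  exact h L hL hvS hvP hS hP

/-- ★★★ **THE FIXED-`L` RELATIVE GAP MODULO PM ONLY** (σ side discharged, periodic side reduced to the two-scale middle bounds). [cite: Griffiths1964] [cite: tHooft1979] -/
theorem relativeGap_fixedL_of_twoScale' {ε : ℝ} (hε : 0 < ε) :
    ∃ L₀ : ℕ, ∀ (L : ℕ) [NeZero L], L₀ ≤ L → ∀ {gI : ℝ}, 0 < gI →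
      (∀ ε' : ℝ, 0 < ε' → ∃ A δ : ℝ, 0 < A ∧ 0 < δ ∧ ∃ G : ℝ → ℝ≥0∞, ∫⁻ x, G x ∂(volume : Measure ℝ) ≤ ENNReal.ofReal (gI + ε') ∧
        ∀ᶠ t in 𝓝[>] (0 : ℝ), ∀ a₀ : ℝ, ∀ ρ ∈ Ioc (A * Real.sqrt t) δ,
          periodicKernel L (fun _ => false) (fun _ => 1) t (t ^ 2) (a₀, ρ) ≤ G a₀ * ENNReal.ofReal ρ⁻¹) →
      (∀ ε' : ℝ, 0 < ε' → ∃ A δ : ℝ, 0 < A ∧ 0 < δ ∧ ∃ G : ℝ → ℝ≥0∞, ENNReal.ofReal (gI - ε') ≤ ∫⁻ x, G x ∂(volume : Measure ℝ) ∧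
        ∀ᶠ t in 𝓝[>] (0 : ℝ), ∀ a₀ : ℝ, ∀ ρ ∈ Ioc (A * Real.sqrt t) δ,
          G a₀ * ENNReal.ofReal ρ⁻¹ ≤ periodicKernel L (fun _ => false) (fun _ => 1) t (t ^ 2) (a₀, ρ)) →
      ∃ β₀ : ℝ, ∀ β : ℝ, β₀ ≤ β →
        β * deriv (fun b : ℝ => Real.log (TT.twistTrace L b (2 * L))) β -
            β * deriv (fun b : ℝ => Real.log (TT.physTrace L b (2 * L))) β ≤ -(1 / 2 - 2 * ε) := by
  obtain ⟨L₀, h⟩ := relativeGap_fixedL_of_periodicLogLimit hε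
  refine ⟨L₀, fun L _ hL gI hgI hup hlo => ?_⟩
  have hc : 0 < coneConst := coneConst_pos
  have hv : 0 < coneConst ^ (6 * L ^ 4 + 1) * gI / 4 := by positivity
  exact h L hL hv (periodicPrincipalLogLimit_of_twoScale L hgI.le hup hlo)

end Summit.QuantumFields.YangMills.Theorems.SwapVirialDeficit.BlowUpRing

end
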